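import Mathlib
import Summits.Ventures.PercRepro2.HCov

/-!
# The four-term identity of (HCOV) and its theorem-signed third term (blind cell PercRepro2, p5 g21)

Under `Q = {a₁ ↮ a₂}` write `L_x = 1_{x ∈ C₁}`, `H_x = 1_{x ∈ C₂}`, `σ̄_b = E[σ_b | Q] = −gap/P(Q)`,
`γ = P(o ∈ U | PD) = D_o/D`.  Exploring the cluster `C₂` first and regrouping, `G = Gc/(D·P(Q))` splits
EXACTLY into four terms (`proofs/P5-OEDGE.md` §27):

  `G/2 = P(T′, bH, oH) + E[1_{oH}(σ̄_b − L_b); PD ∪ T′] + E[1_{bH}(γ − L_o); PD ∪ T] + E[(L_b − σ̄_b)(L_o − γ); T]`.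

Cleared by `D·P(Q)` (**`Gc_eq_four`**): `Gc = 2·(D·P(Q)·Ac + D·Bc + P(Q)·Cc + Dc)` with the four
division-free masses `Ac`, `Bc`, `Cc`, `Dc` below.  The first is a probability; the third is
non-negative on EVERY instance (**`Cc_nonneg`**): `Cc·P(R) = [D_o·P(R) − D·P(R, oL)]·P(R, bH) +
D·[P(R, oL)·P(R, bH) − P(R, oL, bH)·P(R)]` with `R = {a₁ ↮ a₂, a₃}` — the first bracket by the
margin block `ToL_mul_D_le` (BHK06 Thm 1.4, `o` vs `a₃`), the second by `bhk_cross_cluster_avoid`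
(`o ∈ C₁` vs `b ∈ C₂` under `R`).  So (HCOV) reduces to the residual `0 ≤ D·Bc + Dc`
(**`HCov_of_residual`**) — which is NOT a theorem in general (negative on 29 / 60 random instances,
`mining/p5/g21/`), but holds to first order at an infinitesimal pendant root (`P5-OEDGE.md` §27).
-/

namespace Summit.Ventures.PercRepro2

open UnionCluster

namespace CovForm

namespace FourTerm

section Defs

variable {V : Type*} {E : Type*} [Fintype E] [DecidableEq E] [DecidableEq V] {R : Type*}
  [Field R] [LinearOrder R]

/-- `Ac = P(T′, b ∈ C₂, o ∈ C₂)`. -/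
noncomputable def Ac (p : E → R) (ends : E → Sym2 V) (o a₁ a₂ a₃ b : V) : R :=
  prob p (TEvent ends a₂ a₁ a₃ ∩ (connEvent ends a₂ o ∩ connEvent ends a₂ b))

/-- `Bc = P(Q)·E[1_{oH}(σ̄_b − L_b); PD ∪ T′] = −gap·P(PD ∪ T′, oH) − P(Q)·P(PD ∪ T′, oH, bL)`. -/
noncomputable def Bc (p : E → R) (ends : E → Sym2 V) (o a₁ a₂ a₃ b : V) : R :=
  -gap p ends a₁ a₂ b *
      (prob p (PDEvent ends a₁ a₂ a₃ ∩ connEvent ends a₂ o) +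
        prob p (TEvent ends a₂ a₁ a₃ ∩ connEvent ends a₂ o)) -
    prob p (avoidAll ends a₂ {a₁}) *
      (prob p (PDEvent ends a₁ a₂ a₃ ∩ (connEvent ends a₂ o ∩ connEvent ends a₁ b)) +
        prob p (TEvent ends a₂ a₁ a₃ ∩ (connEvent ends a₂ o ∩ connEvent ends a₁ b)))

/-- `Cc = D·E[1_{bH}(γ − L_o); PD ∪ T] = D_o·P(PD ∪ T, bH) − D·P(PD ∪ T, bH, oL)`. -/
noncomputable def Cc (p : E → R) (ends : E → Sym2 V) (o a₁ a₂ a₃ b : V) : R :=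
  Do p ends o a₁ a₂ a₃ *
      (prob p (PDEvent ends a₁ a₂ a₃ ∩ connEvent ends a₂ b) +
        prob p (TEvent ends a₁ a₂ a₃ ∩ connEvent ends a₂ b)) -
    prob p (PDEvent ends a₁ a₂ a₃) *
      (prob p (PDEvent ends a₁ a₂ a₃ ∩ (connEvent ends a₁ o ∩ connEvent ends a₂ b)) +
        prob p (TEvent ends a₁ a₂ a₃ ∩ (connEvent ends a₁ o ∩ connEvent ends a₂ b)))

/-- `Dc = D·P(Q)·E[(L_b − σ̄_b)(L_o − γ); T]
= D·P(Q)·P(T, bL, oL) − P(Q)·D_o·P(T, bL) + D·gap·P(T, oL) − D_o·gap·P(T)`. -/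
noncomputable def Dc (p : E → R) (ends : E → Sym2 V) (o a₁ a₂ a₃ b : V) : R :=
  prob p (PDEvent ends a₁ a₂ a₃) * prob p (avoidAll ends a₂ {a₁}) *
      prob p (TEvent ends a₁ a₂ a₃ ∩ (connEvent ends a₁ o ∩ connEvent ends a₁ b)) -
    prob p (avoidAll ends a₂ {a₁}) * Do p ends o a₁ a₂ a₃ *
      prob p (TEvent ends a₁ a₂ a₃ ∩ connEvent ends a₁ b) +
    prob p (PDEvent ends a₁ a₂ a₃) * gap p ends a₁ a₂ b *
      prob p (TEvent ends a₁ a₂ a₃ ∩ connEvent ends a₁ o) -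
    Do p ends o a₁ a₂ a₃ * gap p ends a₁ a₂ b * prob p (TEvent ends a₁ a₂ a₃)

end Defs

section Identity

variable {V : Type*} {E : Type*} [Fintype E] [DecidableEq E] [DecidableEq V] {R : Type*}
  [Field R] [LinearOrder R] [IsStrictOrderedRing R]

/-- **The four-term identity, cleared**: `Gc = 2·(D·P(Q)·Ac + D·Bc + P(Q)·Cc + Dc)`. -/
theorem Gc_eq_four (p : E → R) (ends : E → Sym2 V) (o a₁ a₂ a₃ b : V) :
    Gc p ends o a₁ a₂ a₃ b =
      2 * (prob p (PDEvent ends a₁ a₂ a₃) * prob p (avoidAll ends a₂ {a₁}) *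
            Ac p ends o a₁ a₂ a₃ b +
          prob p (PDEvent ends a₁ a₂ a₃) * Bc p ends o a₁ a₂ a₃ b +
          prob p (avoidAll ends a₂ {a₁}) * Cc p ends o a₁ a₂ a₃ b +
          Dc p ends o a₁ a₂ a₃ b) := by
  have hg := gap_eq_Q p ends a₁ a₂ b
  unfold Ac Bc Cc Dc Gc DEF EQbo EQb3 EQb3o EQo EQ3 EQ3o PDb PDbo Do
  rw [hg]
  simp only [Qsplit p ends a₁ a₂ a₃, Qsplit_univ p ends a₁ a₂ a₃]
  ring

end Identity

section Sign

variable {V : Type*} {E : Type*} [Fintype E] [DecidableEq E] [Fintype V] [DecidableEq V]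
  {R : Type*} [Field R] [LinearOrder R] [IsStrictOrderedRing R]

/-- **BHK 1.4 for `o ∈ C₁` against `b ∈ C₂` under `R = {a₁ ↮ a₂, a₃}`** (`bhk_cross_cluster_avoid`,
`s = a₁`, `t = a₂`, `X = {a₂, a₃}`): `P(R, oL, bH)·P(R) ≤ P(R, oL)·P(R, bH)`, in `PD ⊔ T` masses. -/
theorem R_oL_bH_mul_le (p : E → R) (hp : IsProbVec p) (ends : E → Sym2 V) (o a₁ a₂ a₃ b : V) :
    (prob p (PDEvent ends a₁ a₂ a₃ ∩ (connEvent ends a₁ o ∩ connEvent ends a₂ b)) +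
        prob p (TEvent ends a₁ a₂ a₃ ∩ (connEvent ends a₁ o ∩ connEvent ends a₂ b))) *
      (prob p (PDEvent ends a₁ a₂ a₃) + prob p (TEvent ends a₁ a₂ a₃)) ≤
    (prob p (PDEvent ends a₁ a₂ a₃ ∩ connEvent ends a₁ o) +
        prob p (TEvent ends a₁ a₂ a₃ ∩ connEvent ends a₁ o)) *
      (prob p (PDEvent ends a₁ a₂ a₃ ∩ connEvent ends a₂ b) +
        prob p (TEvent ends a₁ a₂ a₃ ∩ connEvent ends a₂ b)) := by
  have h := bhk_cross_cluster_avoid p hp ends a₁ a₂ (X := {a₂, a₃}) (Finset.mem_insert_self a₂ {a₃})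
    (isUpperSet_mem_setOf o) (isUpperSet_mem_setOf b)
  rw [← connEvent_eq_clusterInEvent ends a₁ o, ← connEvent_eq_clusterInEvent ends a₂ b] at h
  have hR := ISplit.prob_PD_add_T p ends a₁ a₂ a₃ Set.univ
  simp only [Set.inter_univ] at hR
  have hoR := ISplit.prob_PD_add_T p ends a₁ a₂ a₃ (connEvent ends a₁ o)
  have hbR := ISplit.prob_PD_add_T p ends a₁ a₂ a₃ (connEvent ends a₂ b)
  have hobR := ISplit.prob_PD_add_T p ends a₁ a₂ a₃ (connEvent ends a₁ o ∩ connEvent ends a₂ b)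
  have e1 : connEvent ends a₁ o ∩ connEvent ends a₂ b ∩ avoidAll ends a₁ {a₂, a₃} =
      avoidAll ends a₁ {a₂, a₃} ∩ (connEvent ends a₁ o ∩ connEvent ends a₂ b) := by
    ext ω; simp only [Set.mem_inter_iff]; tauto
  have e2 : connEvent ends a₁ o ∩ avoidAll ends a₁ {a₂, a₃} =
      avoidAll ends a₁ {a₂, a₃} ∩ connEvent ends a₁ o := Set.inter_comm _ _
  have e3 : connEvent ends a₂ b ∩ avoidAll ends a₁ {a₂, a₃} =
      avoidAll ends a₁ {a₂, a₃} ∩ connEvent ends a₂ b := Set.inter_comm _ _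
  rw [e1, e2, e3, ← hobR, ← hoR, ← hbR, ← hR] at h
  exact h

/-- **The third term is non-negative on every instance**: `0 ≤ Cc`. -/
theorem Cc_nonneg (p : E → R) (hp : IsProbVec p) (ends : E → Sym2 V) (o a₁ a₂ a₃ b : V) :
    0 ≤ Cc p ends o a₁ a₂ a₃ b := by
  unfold Cc Do
  -- the masses
  set d := prob p (PDEvent ends a₁ a₂ a₃) with hd
  set t := prob p (TEvent ends a₁ a₂ a₃) with ht
  set doL := prob p (PDEvent ends a₁ a₂ a₃ ∩ connEvent ends a₁ o) with hdoL
  set doH := prob p (PDEvent ends a₁ a₂ a₃ ∩ connEvent ends a₂ o) with hdoH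
  set toL := prob p (TEvent ends a₁ a₂ a₃ ∩ connEvent ends a₁ o) with htoL
  set dbH := prob p (PDEvent ends a₁ a₂ a₃ ∩ connEvent ends a₂ b) with hdbH
  set tbH := prob p (TEvent ends a₁ a₂ a₃ ∩ connEvent ends a₂ b) with htbH
  set dboL := prob p (PDEvent ends a₁ a₂ a₃ ∩ (connEvent ends a₁ o ∩ connEvent ends a₂ b)) with hdboL
  set tboL := prob p (TEvent ends a₁ a₂ a₃ ∩ (connEvent ends a₁ o ∩ connEvent ends a₂ b)) with htboL
  have hbhk := R_oL_bH_mul_le p hp ends o a₁ a₂ a₃ b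
  have hmar := ToL_mul_D_le p hp ends o a₁ a₂ a₃
  have hd0 : 0 ≤ d := prob_nonneg hp _
  have ht0 : 0 ≤ t := prob_nonneg hp _
  have hdoH0 : 0 ≤ doH := prob_nonneg hp _
  have hdoL0 : 0 ≤ doL := prob_nonneg hp _
  have htoL0 : 0 ≤ toL := prob_nonneg hp _
  have hdbH0 : 0 ≤ dbH := prob_nonneg hp _
  have htbH0 : 0 ≤ tbH := prob_nonneg hp _
  have hdboL0 : 0 ≤ dboL := prob_nonneg hp _
  have htboL0 : 0 ≤ tboL := prob_nonneg hp _
  -- `dboL ≤ doL`, `tboL ≤ toL` (monotonicity), `dboL ≤ dbH`, `tboL ≤ tbH`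
  have h1 : dboL ≤ dbH := prob_mono hp (Set.inter_subset_inter_right _ Set.inter_subset_right)
  have h2 : tboL ≤ tbH := prob_mono hp (Set.inter_subset_inter_right _ Set.inter_subset_right)
  -- Case `d + t = 0`: every `PD`/`T` mass vanishes.
  by_cases hR : d + t = 0
  · have hd' : d = 0 := by linarith
    have ht' : t = 0 := by linarith
    have hdbH' : dbH = 0 := le_antisymm (hd' ▸ prob_mono hp Set.inter_subset_left) hdbH0
    have htbH' : tbH = 0 := le_antisymm (ht' ▸ prob_mono hp Set.inter_subset_left) htbH0
    have hdboL' : dboL = 0 := le_antisymm (h1.trans hdbH'.le) hdboL0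
    have htboL' : tboL = 0 := le_antisymm (h2.trans htbH'.le) htboL0
    rw [hd', hdbH', htbH', hdboL', htboL']
    simp
  · have hRpos : 0 < d + t := lt_of_le_of_ne (add_nonneg hd0 ht0) (Ne.symm hR)
    -- `(d + t) · Cc = [(doL + doH)(d + t) − d·(doL + toL)]·(dbH + tbH) + d·[(doL + toL)(dbH + tbH) − (dboL + tboL)(d + t)]`
    have key : 0 ≤ ((doL + doH) * (dbH + tbH) - d * (dboL + tboL)) * (d + t) := by
      have hA : 0 ≤ ((doL + doH) * (d + t) - d * (doL + toL)) * (dbH + tbH) := by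
        apply mul_nonneg _ (add_nonneg hdbH0 htbH0)
        nlinarith [hmar, mul_nonneg hdoH0 (add_nonneg hd0 ht0)]
      have hB : 0 ≤ d * ((doL + toL) * (dbH + tbH) - (dboL + tboL) * (d + t)) :=
        mul_nonneg hd0 (by linarith [hbhk])
      nlinarith [hA, hB]
    exact nonneg_of_mul_nonneg_left key hRpos

end Sign

section Reduction

variable {V : Type*} {E : Type*} [Fintype E] [DecidableEq E] [Fintype V] [DecidableEq V]
  {R : Type*} [Field R] [LinearOrder R] [IsStrictOrderedRing R]

/-- **(HCOV) from the residual**: `0 ≤ D·Bc + Dc` gives `HCov` (the first and third terms being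
non-negative by `prob_nonneg` and `Cc_nonneg`).  The hypothesis is NOT a theorem in general — it
fails on 29 / 60 random instances (`mining/p5/g21/`); it holds to first order at an infinitesimal
pendant root (`proofs/P5-OEDGE.md` §27). -/
theorem HCov_of_residual (p : E → R) (hp : IsProbVec p) (ends : E → Sym2 V) (o a₁ a₂ a₃ b : V)
    (h : 0 ≤ prob p (PDEvent ends a₁ a₂ a₃) * Bc p ends o a₁ a₂ a₃ b + Dc p ends o a₁ a₂ a₃ b) :
    HCov p ends o a₁ a₂ a₃ b := by
  unfold HCov
  rw [Gc_eq_four]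
  have hA : 0 ≤ Ac p ends o a₁ a₂ a₃ b := prob_nonneg hp _
  have hC := Cc_nonneg p hp ends o a₁ a₂ a₃ b
  have hd := prob_nonneg hp (PDEvent ends a₁ a₂ a₃)
  have hq := prob_nonneg hp (avoidAll ends a₂ {a₁})
  nlinarith [mul_nonneg (mul_nonneg hd hq) hA, mul_nonneg hq hC]

end Reduction

end FourTerm

end CovForm

end Summit.Ventures.PercRepro2
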